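import Summits.MatrixMultiplication.OmegaCensus.PeriodicTilingDefect
import HarnessLib

/-!
# No `law − 4` triple of shape P3 in dicyclic type

ω-census, family (b3).  Framing: lottery ticket; floor = certified bounds/negative ranges.

Dihedral-like `G(A, c₀)` with `c₀ ≠ 0` (dicyclic type).  `DicyclicNoSubFourP5.lean` left exactly one shape for a TPP
triple with `3|S||T||U| + 20 = 8|A|` when `A/⟨c₀⟩` is not cyclic: P3, coset parts `(c+1, c | 1,1 | 3,3)` up to roles,
`|A| = 9c + 7`; `DicyclicSubFourP3Structure.lean` proved that the big `ρ`-part `S₀` of such a triple is `c₀`-periodic.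
This file proves that **P3 does not occur either** (`no_sub_four_P3_of_c0_ne_zero`), by a purely combinatorial
argument (no characters):

* write `T = {ρ t, τ b}`.  Vertex `000` of `(S,T,U)` is a near-tiling `S₁+t+U₀ ⊔ S₀+b+U₀ ⊔ S₀+t+U₁ = A ∖ {p}` whose
  last two boxes are periodic, so the box `S₁ + t + U₀` has at most ONE point whose `c₀`-partner is missing; by the
  reflection invariance of this count (`card_partnerless_reflect`) the same holds for the box
  `B₂ = (−c₀ − S₁) + b + U₀` of the translate `S·τ0`;
* vertex `000` of `(S·τ0, T, U)` has the pairwise disjoint boxes `B₁ = −S₀ + t + U₀`, `B₂`, `B₃ = −c₀ − S₁ + t + U₁`,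
  and `(S·τ0, T·τ0, U)` adds `B₂ ∩ (B₃ + c₀) = ∅`; vertex `000` of `(S, T, U·τ0)` is a near-tiling
  `N₁ ⊔ N₂ ⊔ N₃ = A ∖ {p'}` with `B₃ = 2t − N₁`, `B₁ = 2t − N₃`; hence `B₂ ⊆ 2t − N₂ = (2t − b − S₀) + U₁`, a periodic
  set tiled by the classes `(2t − b − S₀) + u'`, `u' ∈ U₁`;
* the offset lemma `periodic_tiling_defect` (the three points of a tile `q + U₀` lie in distinct classes because
  `S₀ + U₀` is injective) then produces two partner-less points of `B₂` — contradiction.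
-/

namespace Summit.MatrixMultiplication.OmegaCensus

open Literature.Combinatorics.Additive Finset

section Boxes

variable {A : Type*} [AddCommGroup A] [DecidableEq A]

/-- A threefold sumset with singleton middle factor as a twofold sumset of the shifted first factor. [folklore] -/
theorem sumset₃_singleton_eq (X Z : Finset A) (y : A) :
    ((X ×ˢ ({y} : Finset A) ×ˢ Z).image fun p : A × A × A => p.1 + p.2.1 + p.2.2) =
      ((X.image (· + y)) ×ˢ Z).image fun p : A × A => p.1 + p.2 := by
  ext x
  simp only [mem_image, mem_product, mem_singleton, Prod.exists]
  constructor
  · rintro ⟨a, b, c, ⟨ha, rfl, hc⟩, rfl⟩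
    exact ⟨a + b, c, ⟨⟨a, ha, rfl⟩, hc⟩, rfl⟩
  · rintro ⟨ay, c, ⟨⟨a, ha, rfl⟩, hc⟩, rfl⟩
    exact ⟨a, y, c, ⟨ha, rfl, hc⟩, rfl⟩

/-- Pairwise injectivity of `(X + y) + Z` from `Set.InjOn` on the box `X × {y} × Z`. [folklore] -/
theorem pairs_of_sum_injOn {X Z : Finset A} {y : A}
    (h : Set.InjOn (fun p : A × A × A => p.1 + p.2.1 + p.2.2) ↑(X ×ˢ ({y} : Finset A) ×ˢ Z)) :
    ∀ a ∈ X.image (· + y), ∀ a' ∈ X.image (· + y), ∀ c ∈ Z, ∀ c' ∈ Z, a + c = a' + c' → a = a' ∧ c = c' := by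
  intro a ha a' ha' c hc c' hc' he
  obtain ⟨x, hx, rfl⟩ := mem_image.1 ha
  obtain ⟨x', hx', rfl⟩ := mem_image.1 ha'
  have h1 : ((x, y, c) : A × A × A) ∈ (↑(X ×ˢ ({y} : Finset A) ×ˢ Z) : Set (A × A × A)) := by
    simp [hx, hc]
  have h2 : ((x', y, c') : A × A × A) ∈ (↑(X ×ˢ ({y} : Finset A) ×ˢ Z) : Set (A × A × A)) := by
    simp [hx', hc']
  have key := h h1 h2 he
  simp only [Prod.mk.injEq] at key
  exact ⟨by rw [key.1], key.2.2⟩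

/-- A box whose first factor is `c₀`-periodic is `c₀`-periodic. [folklore] -/
theorem box_add_mem_of_fst {X Y Z : Finset A} {c₀ : A} (hX : ∀ x ∈ X, x + c₀ ∈ X) {w : A}
    (hw : w ∈ (X ×ˢ Y ×ˢ Z).image fun p : A × A × A => p.1 + p.2.1 + p.2.2) :
    w + c₀ ∈ (X ×ˢ Y ×ˢ Z).image fun p : A × A × A => p.1 + p.2.1 + p.2.2 := by
  rw [mem_sumset₃] at hw ⊢
  obtain ⟨a, ha, b, hb, c, hc, rfl⟩ := hw
  exact ⟨a + c₀, hX a ha, b, hb, c, hc, by abel⟩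

end Boxes

section DihedralLike

variable {A : Type*} [AddCommGroup A] [DecidableEq A] [Fintype A] {G : Type} [Group G] [DecidableEq G]
  {ρ τ : A → G} {c₀ : A} {S T U : Finset G}

/-- Core of the P3 exclusion (orientation: the `ρ`-part of `S` is the larger one).  Dicyclic type `c₀ ≠ 0`; a TPP
triple with parts `(s₁+1, s₁ | 1,1 | 3,3)` and `3|S||T||U| + 20 = 8|A|` does not exist. [folklore] -/
theorem no_sub_four_P3_core
    (hρρ : ∀ a b, ρ a * ρ b = ρ (a + b)) (hρτ : ∀ a b, ρ a * τ b = τ (b - a))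
    (hτρ : ∀ a b, τ a * ρ b = τ (a + b)) (hττ : ∀ a b, τ a * τ b = ρ (c₀ + b - a)) (hc₀ : c₀ ≠ 0)
    (hρ : Function.Injective ρ) (hτ : Function.Injective τ) (hne : ∀ a b, ρ a ≠ τ b)
    (hsurj : ∀ g, (∃ a, ρ a = g) ∨ (∃ a, τ a = g)) (h : TripleProductProperty S T U)
    (hs : (univ.filter fun a : A => ρ a ∈ S).card = (univ.filter fun a : A => τ a ∈ S).card + 1)
    (ht₀ : (univ.filter fun a : A => ρ a ∈ T).card = 1) (ht₁ : (univ.filter fun a : A => τ a ∈ T).card = 1)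
    (hu₀ : (univ.filter fun a : A => ρ a ∈ U).card = 3) (hu₁ : (univ.filter fun a : A => τ a ∈ U).card = 3)
    (hV : 3 * (S.card * T.card * U.card) + 20 = 8 * Fintype.card A) : False := by
  set S₀ : Finset A := univ.filter fun a => ρ a ∈ S with hS₀
  set S₁ : Finset A := univ.filter fun a => τ a ∈ S with hS₁
  set T₀ : Finset A := univ.filter fun a => ρ a ∈ T with hT₀
  set T₁ : Finset A := univ.filter fun a => τ a ∈ T with hT₁
  set U₀ : Finset A := univ.filter fun a => ρ a ∈ U with hU₀
  set U₁ : Finset A := univ.filter fun a => τ a ∈ U with hU₁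
  have h2c := two_c0_eq_zero hρτ hτρ hττ hτ
  -- (0) the big `ρ`-part is periodic (structure theorem)
  have hper : S₀.image (· + c₀) = S₀ :=
    dicyclic_P3_rho_part_periodic hρρ hρτ hτρ hττ hc₀ hρ hτ hne hsurj h hs ht₀ ht₁ hu₀ hu₁ hV
  have hS₀c : ∀ s ∈ S₀, s + c₀ ∈ S₀ := fun s hs' => by rw [← hper]; exact mem_image_of_mem _ hs'
  obtain ⟨t, hT₀t⟩ := card_eq_one.1 ht₀
  obtain ⟨b, hT₁b⟩ := card_eq_one.1 ht₁
  have cS : S.card = S₀.card + S₁.card := card_eq_parts' hρ hτ hne hsurj S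
  have cT : T.card = T₀.card + T₁.card := card_eq_parts' hρ hτ hne hsurj T
  have cU : U.card = U₀.card + U₁.card := card_eq_parts' hρ hτ hne hsurj U
  rw [cS, cT, cU, hs, ht₀, ht₁, hu₀, hu₁] at hV
  have mS₀ : ∀ a ∈ S₀, cond false (τ a) (ρ a) ∈ S := fun a ha => by simpa [hS₀] using ha
  have mS₁ : ∀ a ∈ S₁, cond true (τ a) (ρ a) ∈ S := fun a ha => by simpa [hS₁] using ha
  have mT₀ : ∀ a ∈ T₀, cond false (τ a) (ρ a) ∈ T := fun a ha => by simpa [hT₀] using ha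
  have mT₁ : ∀ a ∈ T₁, cond true (τ a) (ρ a) ∈ T := fun a ha => by simpa [hT₁] using ha
  have mU₀ : ∀ a ∈ U₀, cond false (τ a) (ρ a) ∈ U := fun a ha => by simpa [hU₀] using ha
  have mU₁ : ∀ a ∈ U₁, cond true (τ a) (ρ a) ∈ U := fun a ha => by simpa [hU₁] using ha
  -- (1) vertex 000 of `(S, T, U)`: `P₁ ⊔ Q₁ ⊔ R₁ = A ∖ {p}`
  have cs := card_sumset' hρρ hττ hρ hτ h
  have inj := sum_injOn' hρρ hττ hρ hτ h
  have d₁ := disjoint_sumset₁' hρρ hρτ hτρ hττ hne h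
  have d₂ := disjoint_sumset₂' hρρ hρτ hτρ hττ hne h
  have d₃ := disjoint_sumset₃' hρρ hρτ hτρ hττ hne h
  set P₁ := (S₁ ×ˢ T₀ ×ˢ U₀).image fun p : A × A × A => p.1 + p.2.1 + p.2.2 with hP₁
  set Q₁ := (S₀ ×ˢ T₁ ×ˢ U₀).image fun p : A × A × A => p.1 + p.2.1 + p.2.2 with hQ₁
  set R₁ := (S₀ ×ˢ T₀ ×ˢ U₁).image fun p : A × A × A => p.1 + p.2.1 + p.2.2 with hR₁
  have hPQ : Disjoint P₁ Q₁ := d₁ false mS₁ mT₀ mU₀ mS₀ mT₁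
  have hPR : Disjoint P₁ R₁ := (d₃ false mS₀ mT₀ mU₁ mS₁ mU₀).symm
  have hQR : Disjoint Q₁ R₁ := d₂ false mS₀ mT₁ mU₀ mS₀ mT₀ mU₁
  obtain ⟨p, hp⟩ := exists_missed_point hPQ hPR hQR (by
    rw [hP₁, hQ₁, hR₁, cs true false false mS₁ mT₀ mU₀, cs false true false mS₀ mT₁ mU₀,
      cs false false true mS₀ mT₀ mU₁, hT₀t, hT₁b, card_singleton, card_singleton, hu₀, hu₁, hs]; omega)
  have hE : ∀ e ∈ univ \ (Q₁ ∪ R₁), e + c₀ ∈ univ \ (Q₁ ∪ R₁) := by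
    intro e he
    simp only [mem_sdiff, mem_univ, true_and, mem_union, not_or] at he ⊢
    refine ⟨fun hc => he.1 ?_, fun hc => he.2 ?_⟩
    · have := box_add_mem_of_fst hS₀c hc; rwa [add_assoc, h2c, add_zero] at this
    · have := box_add_mem_of_fst hS₀c hc; rwa [add_assoc, h2c, add_zero] at this
  have hPE : P₁ ⊆ univ \ (Q₁ ∪ R₁) := by
    intro x hx
    simp only [mem_sdiff, mem_univ, true_and, mem_union, not_or]
    exact ⟨fun hq => disjoint_left.1 hPQ hx hq, fun hr => disjoint_left.1 hPR hx hr⟩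
  have hdiff : (univ \ (Q₁ ∪ R₁)) \ P₁ = {p} := by
    rw [← hp]; ext x
    simp only [mem_sdiff, mem_univ, true_and, mem_union, not_or]
    tauto
  have sing₁ : (P₁.filter fun z => z + c₀ ∉ P₁).card ≤ 1 :=
    (card_filter_add_notMem_le hE hPE).trans (by rw [hdiff, card_singleton])
  -- (2) the translates `S·τ0`, `T·τ0`, `U·τ0`
  have er : (Equiv.mulRight (1 : G)).toEmbedding = Function.Embedding.refl G := by ext x; simp
  have hS' := h.map_mulRight (τ 0) 1 1
  have hU' := h.map_mulRight 1 1 (τ 0)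
  have hS'T' := h.map_mulRight (τ 0) (τ 0) 1
  simp only [er, Finset.map_refl] at hS' hU' hS'T'
  set S' := S.map (Equiv.mulRight (τ 0)).toEmbedding with hS'def
  set T' := T.map (Equiv.mulRight (τ 0)).toEmbedding with hT'def
  set U' := U.map (Equiv.mulRight (τ 0)).toEmbedding with hU'def
  set S₀' : Finset A := univ.filter fun a => ρ a ∈ S' with hS₀'
  set S₁' : Finset A := univ.filter fun a => τ a ∈ S' with hS₁'
  set T₀' : Finset A := univ.filter fun a => ρ a ∈ T' with hT₀'
  set T₁' : Finset A := univ.filter fun a => τ a ∈ T' with hT₁'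
  set U₀' : Finset A := univ.filter fun a => ρ a ∈ U' with hU₀'
  set U₁' : Finset A := univ.filter fun a => τ a ∈ U' with hU₁'
  have eS₀' : S₀' = S₁.image fun x => -c₀ - x := by rw [hS₀', hS'def, rho_part_mulRight_tau hρρ hρτ hττ, ← hS₁]
  have eS₁' : S₁' = S₀.image fun x => -x := by rw [hS₁', hS'def, tau_part_mulRight_tau hρρ hττ, ← hS₀]
  have eT₀' : T₀' = {-c₀ - b} := by
    rw [hT₀', hT'def, rho_part_mulRight_tau hρρ hρτ hττ, ← hT₁, hT₁b, image_singleton]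
  have eT₁' : T₁' = {-t} := by
    rw [hT₁', hT'def, tau_part_mulRight_tau hρρ hττ, ← hT₀, hT₀t, image_singleton]
  have eU₀' : U₀' = U₁.image fun x => -c₀ - x := by rw [hU₀', hU'def, rho_part_mulRight_tau hρρ hρτ hττ, ← hU₁]
  have eU₁' : U₁' = U₀.image fun x => -x := by rw [hU₁', hU'def, tau_part_mulRight_tau hρρ hττ, ← hU₀]
  have mS₀' : ∀ a ∈ S₀', cond false (τ a) (ρ a) ∈ S' := fun a ha => by simpa [hS₀'] using ha
  have mS₁' : ∀ a ∈ S₁', cond true (τ a) (ρ a) ∈ S' := fun a ha => by simpa [hS₁'] using ha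
  have mT₀' : ∀ a ∈ T₀', cond false (τ a) (ρ a) ∈ T' := fun a ha => by simpa [hT₀'] using ha
  have mT₁' : ∀ a ∈ T₁', cond true (τ a) (ρ a) ∈ T' := fun a ha => by simpa [hT₁'] using ha
  have mU₀' : ∀ a ∈ U₀', cond false (τ a) (ρ a) ∈ U' := fun a ha => by simpa [hU₀'] using ha
  have mU₁' : ∀ a ∈ U₁', cond true (τ a) (ρ a) ∈ U' := fun a ha => by simpa [hU₁'] using ha
  -- (3) vertex 000 of `(S·τ0, T, U)`: boxes `B₁, B₂, B₃`, pairwise disjoint, and `B₂ ∩ (B₃ + c₀) = ∅`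
  set B₁ := (S₁' ×ˢ T₀ ×ˢ U₀).image fun p : A × A × A => p.1 + p.2.1 + p.2.2 with hB₁
  set B₂ := (S₀' ×ˢ T₁ ×ˢ U₀).image fun p : A × A × A => p.1 + p.2.1 + p.2.2 with hB₂
  set B₃ := (S₀' ×ˢ T₀ ×ˢ U₁).image fun p : A × A × A => p.1 + p.2.1 + p.2.2 with hB₃
  have dB₁₂ : Disjoint B₁ B₂ := (disjoint_sumset₁' hρρ hρτ hτρ hττ hne hS') false mS₁' mT₀ mU₀ mS₀' mT₁
  have dB₂₃ : Disjoint B₂ B₃ := (disjoint_sumset₂' hρρ hρτ hτρ hττ hne hS') false mS₀' mT₁ mU₀ mS₀' mT₀ mU₁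
  have dK := (disjoint_sumset₂' hρρ hρτ hτρ hττ hne hS'T') false mS₀' mT₁' mU₀ mS₀' mT₀' mU₁
  have hK : ∀ z ∈ B₂, z + c₀ ∉ B₃ := by
    intro z hz hz'
    rw [hB₂, mem_sumset₃] at hz
    rw [hB₃, mem_sumset₃] at hz'
    obtain ⟨a, ha, y, hy, c, hc, rfl⟩ := hz
    obtain ⟨a', ha', y', hy', c', hc', he⟩ := hz'
    rw [hT₁b, mem_singleton] at hy
    rw [hT₀t, mem_singleton] at hy'
    subst y y'
    have h1 : a + -t + c ∈ (S₀' ×ˢ T₁' ×ˢ U₀).image fun p : A × A × A => p.1 + p.2.1 + p.2.2 :=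
      mem_sumset₃.2 ⟨a, ha, -t, by rw [eT₁']; exact mem_singleton_self _, c, hc, rfl⟩
    have h2 : a + -t + c ∈ (S₀' ×ˢ T₀' ×ˢ U₁).image fun p : A × A × A => p.1 + p.2.1 + p.2.2 :=
      mem_sumset₃.2 ⟨a', ha', -c₀ - b, by rw [eT₀']; exact mem_singleton_self _, c', hc', by
        linear_combination (norm := abel1) he⟩
    exact disjoint_left.1 dK h1 h2
  -- (4) vertex 000 of `(S, T, U·τ0)`: near-tiling `N₁ ⊔ N₂ ⊔ N₃ = A ∖ {p'}`
  set N₁ := (S₁ ×ˢ T₀ ×ˢ U₀').image fun p : A × A × A => p.1 + p.2.1 + p.2.2 with hN₁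
  set N₂ := (S₀ ×ˢ T₁ ×ˢ U₀').image fun p : A × A × A => p.1 + p.2.1 + p.2.2 with hN₂
  set N₃ := (S₀ ×ˢ T₀ ×ˢ U₁').image fun p : A × A × A => p.1 + p.2.1 + p.2.2 with hN₃
  have cs' := card_sumset' hρρ hττ hρ hτ hU'
  have hN₁₂ : Disjoint N₁ N₂ := (disjoint_sumset₁' hρρ hρτ hτρ hττ hne hU') false mS₁ mT₀ mU₀' mS₀ mT₁
  have hN₁₃ : Disjoint N₁ N₃ := ((disjoint_sumset₃' hρρ hρτ hτρ hττ hne hU') false mS₀ mT₀ mU₁' mS₁ mU₀').symm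
  have hN₂₃ : Disjoint N₂ N₃ := (disjoint_sumset₂' hρρ hρτ hτρ hττ hne hU') false mS₀ mT₁ mU₀' mS₀ mT₀ mU₁'
  have cU₀' : U₀'.card = 3 := by rw [eU₀', card_image_of_injective _ sub_right_injective, hu₁]
  have cU₁' : U₁'.card = 3 := by rw [eU₁', card_image_of_injective _ neg_injective, hu₀]
  obtain ⟨p', hp'⟩ := exists_missed_point hN₁₂ hN₁₃ hN₂₃ (by
    rw [hN₁, hN₂, hN₃, cs' true false false mS₁ mT₀ mU₀', cs' false true false mS₀ mT₁ mU₀',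
      cs' false false true mS₀ mT₀ mU₁', hT₀t, hT₁b, card_singleton, card_singleton, cU₀', cU₁', hs]; omega)
  have hp'c : p' + c₀ ∈ N₁ := by
    have hp'mem : p' ∈ univ \ (N₁ ∪ N₂ ∪ N₃) := by rw [hp']; exact mem_singleton_self _
    simp only [mem_sdiff, mem_univ, true_and, mem_union, not_or] at hp'mem
    obtain ⟨⟨-, h2⟩, h3⟩ := hp'mem
    by_contra hc
    have hc2 : p' + c₀ ∉ N₂ := fun hh => h2 (by
      have := box_add_mem_of_fst hS₀c hh; rwa [add_assoc, h2c, add_zero] at this)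
    have hc3 : p' + c₀ ∉ N₃ := fun hh => h3 (by
      have := box_add_mem_of_fst hS₀c hh; rwa [add_assoc, h2c, add_zero] at this)
    have hmem : p' + c₀ ∈ univ \ (N₁ ∪ N₂ ∪ N₃) := by
      simp only [mem_sdiff, mem_univ, true_and, mem_union, not_or]; exact ⟨⟨hc, hc2⟩, hc3⟩
    rw [hp', mem_singleton] at hmem
    exact hc₀ (by simpa using hmem)
  -- (5) containment: `B₂ ⊆ (2t − b + c₀ − S₀) + U₁`
  have hcont : ∀ z ∈ B₂, ∃ s ∈ S₀, ∃ u ∈ U₁, t + t - b + c₀ - s + u = z := by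
    intro z hz
    have hz₁ : z ∉ B₁ := fun h' => disjoint_left.1 dB₁₂ h' hz
    have hz₃ : z ∉ B₃ := fun h' => disjoint_left.1 dB₂₃ hz h'
    have hzK := hK z hz
    by_cases hw₁ : t + t - z ∈ N₁
    · exfalso; apply hz₃
      rw [hN₁, mem_sumset₃] at hw₁
      obtain ⟨a, ha, y, hy, c, hc, he⟩ := hw₁
      rw [hT₀t, mem_singleton] at hy
      subst y
      rw [eU₀'] at hc
      obtain ⟨u, hu, rfl⟩ := mem_image.1 hc
      rw [hB₃]
      exact mem_sumset₃.2 ⟨-c₀ - a, by rw [eS₀']; exact mem_image_of_mem _ ha, t, by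
        rw [hT₀t]; exact mem_singleton_self _, u, hu, by linear_combination (norm := abel1) -he - h2c⟩
    by_cases hw₃ : t + t - z ∈ N₃
    · exfalso; apply hz₁
      rw [hN₃, mem_sumset₃] at hw₃
      obtain ⟨a, ha, y, hy, c, hc, he⟩ := hw₃
      rw [hT₀t, mem_singleton] at hy
      subst y
      rw [eU₁'] at hc
      obtain ⟨u, hu, rfl⟩ := mem_image.1 hc
      rw [hB₁]
      exact mem_sumset₃.2 ⟨-a, by rw [eS₁']; exact mem_image_of_mem _ ha, t, by
        rw [hT₀t]; exact mem_singleton_self _, u, hu, by linear_combination (norm := abel1) -he⟩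
    by_cases hw₀ : t + t - z = p'
    · exfalso; apply hzK
      rw [hN₁, mem_sumset₃] at hp'c
      obtain ⟨a, ha, y, hy, c, hc, he⟩ := hp'c
      rw [hT₀t, mem_singleton] at hy
      subst y
      rw [eU₀'] at hc
      obtain ⟨u, hu, rfl⟩ := mem_image.1 hc
      rw [hB₃]
      exact mem_sumset₃.2 ⟨-c₀ - a, by rw [eS₀']; exact mem_image_of_mem _ ha, t, by
        rw [hT₀t]; exact mem_singleton_self _, u, hu, by
          linear_combination (norm := abel1) -he + hw₀ - h2c - h2c⟩
    · have hmem : t + t - z ∈ N₁ ∪ N₂ ∪ N₃ := by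
        by_contra hn
        have h' : t + t - z ∈ univ \ (N₁ ∪ N₂ ∪ N₃) := mem_sdiff.2 ⟨mem_univ _, hn⟩
        rw [hp', mem_singleton] at h'
        exact hw₀ h'
      rcases mem_union.1 hmem with h12 | h3
      · rcases mem_union.1 h12 with h1 | h2
        · exact absurd h1 hw₁
        · rw [hN₂, mem_sumset₃] at h2
          obtain ⟨a, ha, y, hy, c, hc, he⟩ := h2
          rw [hT₁b, mem_singleton] at hy
          subst y
          rw [eU₀'] at hc
          obtain ⟨u, hu, rfl⟩ := mem_image.1 hc
          exact ⟨a, ha, u, hu, by linear_combination (norm := abel1) -he⟩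
      · exact absurd h3 hw₃
  -- (6) the offset lemma for `Q + U₀ ⊆ P + U₁`
  set X := S₁.image (· + t) with hX
  have hXY := pairs_of_sum_injOn (by rw [← hT₀t]; exact inj true false false mS₁ mT₀ mU₀)
  rw [← hX] at hXY
  have iSU₀ := pairs_of_sum_injOn (by rw [← hT₀t]; exact inj false false false mS₀ mT₀ mU₀)
  have iSU₁ := pairs_of_sum_injOn (by rw [← hT₀t]; exact inj false false true mS₀ mT₀ mU₁)
  set κ := t + t - b + c₀ with hκ
  set P := S₀.image fun s => κ - s with hP
  set Q := X.image fun x => -c₀ + b + t - x with hQ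
  have eQ : (S₀'.image (· + b)) = Q := by
    rw [eS₀', hQ, hX]
    ext x
    simp only [mem_image, exists_exists_and_eq_and]
    constructor
    · rintro ⟨s, hs', rfl⟩; exact ⟨s, hs', by abel⟩
    · rintro ⟨s, hs', rfl⟩; exact ⟨s, hs', by abel⟩
  have eB₂ : B₂ = (Q ×ˢ U₀).image fun p : A × A => p.1 + p.2 := by
    rw [hB₂, hT₁b, sumset₃_singleton_eq, eQ]
  have eP₁ : P₁ = (X ×ˢ U₀).image fun p : A × A => p.1 + p.2 := by
    rw [hP₁, hT₀t, sumset₃_singleton_eq]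
  have key := periodic_tiling_defect (P := P) (Q := Q) (D := U₀) (D' := U₁) hc₀ h2c
    (fun q hq => by
      rw [hP] at hq ⊢
      obtain ⟨s, hs', rfl⟩ := mem_image.1 hq
      exact mem_image.2 ⟨s + c₀, hS₀c s hs', by linear_combination (norm := abel1) -h2c⟩)
    (fun q hq q' hq' d hd d' hd' he => by
      rw [hP] at hq hq'
      obtain ⟨s, hs', rfl⟩ := mem_image.1 hq
      obtain ⟨s', hs'', rfl⟩ := mem_image.1 hq'
      obtain ⟨e1, e2⟩ := iSU₁ (s' + t) (mem_image_of_mem _ hs'') (s + t) (mem_image_of_mem _ hs') d hd d' hd'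
        (by linear_combination (norm := abel1) he)
      exact ⟨by rw [add_left_injective t e1], e2⟩)
    (fun q hq q' hq' d hd d' hd' he => by
      rw [hP] at hq hq'
      obtain ⟨s, hs', rfl⟩ := mem_image.1 hq
      obtain ⟨s', hs'', rfl⟩ := mem_image.1 hq'
      exact (iSU₀ (s' + t) (mem_image_of_mem _ hs'') (s + t) (mem_image_of_mem _ hs') d hd d' hd'
        (by linear_combination (norm := abel1) he)).2)
    (fun q hq q' hq' d hd d' hd' he => by
      rw [hQ] at hq hq'
      obtain ⟨x, hx, rfl⟩ := mem_image.1 hq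
      obtain ⟨x', hx', rfl⟩ := mem_image.1 hq'
      obtain ⟨e1, e2⟩ := hXY x' hx' x hx d hd d' hd' (by linear_combination (norm := abel1) he)
      exact ⟨by rw [e1], e2⟩)
    (fun q hq d hd => by
      have hz : q + d ∈ B₂ := by rw [eB₂]; exact mem_image.2 ⟨(q, d), mem_product.2 ⟨hq, hd⟩, rfl⟩
      obtain ⟨s, hs', u, hu, he⟩ := hcont _ hz
      exact ⟨κ - s, by rw [hP]; exact mem_image_of_mem _ hs', u, hu, by rw [hκ]; exact he⟩)
    (by
      rw [hP, hQ, card_image_of_injective _ sub_right_injective, card_image_of_injective _ sub_right_injective,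
        hX, card_image_of_injective _ (add_left_injective t), hs])
    (by rw [hu₀, hu₁]) (by rw [hu₁]; norm_num)
  have hrefl := card_partnerless_reflect c₀ (-c₀ + b + t) hXY (Y := U₀)
  rw [← hQ, ← eB₂, ← eP₁] at hrefl
  rw [← eB₂] at key
  omega

/-- **No P3 triple in dicyclic type.** Dihedral-like `G(A,c₀)` with `c₀ ≠ 0`: there is no TPP triple with coset
parts `(c+1, c | 1,1 | 3,3)` or `(c, c+1 | 1,1 | 3,3)` attaining `3|S||T||U| + 20 = 8|A|` (the `law − 4` shape P3
of `VertexCountingSubFourShape.lean`). [folklore] -/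
theorem no_sub_four_P3_of_c0_ne_zero
    (hρρ : ∀ a b, ρ a * ρ b = ρ (a + b)) (hρτ : ∀ a b, ρ a * τ b = τ (b - a))
    (hτρ : ∀ a b, τ a * ρ b = τ (a + b)) (hττ : ∀ a b, τ a * τ b = ρ (c₀ + b - a)) (hc₀ : c₀ ≠ 0)
    (hρ : Function.Injective ρ) (hτ : Function.Injective τ) (hne : ∀ a b, ρ a ≠ τ b)
    (hsurj : ∀ g, (∃ a, ρ a = g) ∨ (∃ a, τ a = g)) (h : TripleProductProperty S T U)
    (hs : (univ.filter fun a : A => ρ a ∈ S).card = (univ.filter fun a : A => τ a ∈ S).card + 1 ∨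
      (univ.filter fun a : A => τ a ∈ S).card = (univ.filter fun a : A => ρ a ∈ S).card + 1)
    (ht₀ : (univ.filter fun a : A => ρ a ∈ T).card = 1) (ht₁ : (univ.filter fun a : A => τ a ∈ T).card = 1)
    (hu₀ : (univ.filter fun a : A => ρ a ∈ U).card = 3) (hu₁ : (univ.filter fun a : A => τ a ∈ U).card = 3)
    (hV : 3 * (S.card * T.card * U.card) + 20 = 8 * Fintype.card A) : False := by
  rcases hs with hs | hs
  · exact no_sub_four_P3_core hρρ hρτ hτρ hττ hc₀ hρ hτ hne hsurj h hs ht₀ ht₁ hu₀ hu₁ hV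
  · -- swap the parts of `S` by the right translation `S ↦ S·τ0`
    have er : (Equiv.mulRight (1 : G)).toEmbedding = Function.Embedding.refl G := by ext x; simp
    have hS' := h.map_mulRight (τ 0) 1 1
    simp only [er, Finset.map_refl] at hS'
    have cρ := card_rho_part_mulRight_tau hρρ hρτ hττ (A := A) S
    have cτ := card_tau_part_mulRight_tau hρρ hττ (A := A) S
    exact no_sub_four_P3_core hρρ hρτ hτρ hττ hc₀ hρ hτ hne hsurj hS' (by rw [cρ, cτ, hs]) ht₀ ht₁ hu₀ hu₁
      (by rw [card_map]; exact hV)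

end DihedralLike

end Summit.MatrixMultiplication.OmegaCensus
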